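import Mathlib.Combinatorics.SetFamily.FourFunctions
import Mathlib.Combinatorics.SetFamily.Compression.Down
import Mathlib.Tactic
import HarnessLib
import HarnessLib.Audit.Tags
import Summits.CriticalPhenomena.PercolationContinuityZ3.Theorems.PercNearOneGluingNoHeavyLowerTailSahiTypeSetDaykin
import Summits.CriticalPhenomena.PercolationContinuityZ3.Theorems.PercNearOneGluingNoHeavyLowerTailSahiRainbowTwoColourTwins

/-!
# `TypeSetSignedDaykin` is closed under compression: the projection is an instance, its compatible meets are EXACTLY the
# projected compatible meets, and the weight bookkeeping (the slack identity)

Support file (seat `prim-masterthm-p1`, gen 43; `--supports stmt-CriticalPhenomena-4575`).  One definition (`projTypes`, the union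
type-set of a projected member) and one weight function (`tsWeight`); theorems only otherwise; no `sorry`, standard axioms.
Memo `run/shared/lean/prim/prim-masterthm/FROM-prim-masterthm-p1-g43-TYPE-SETS.md` §2.

CONTEXT (`…SahiTypeSetDaykin`, gen 43).  A type-set configuration is a complement-closed `Z ⊆ 2^G` with nonempty equivariant
type-sets `L z ⊆ ℕ × Bool`; `typeMeets Z L` = meets of compatible pairs; the conjecture `TypeSetSignedDaykin` reads
`Σ_{z ∈ Z} tsWeight (L z) ≤ 2 · #typeMeets Z L` with `tsWeight S = 1 + [S self-compatible]` (`sum_tsWeight_eq`).  The point of the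
type-set language is that compression at a point `y ∈ G` STAYS INSIDE THE CLASS, canonically:

* `projTypes Z L y u` = the union of the type-sets of the lifts `u`, `insert y u` of a `y`-free set `u` that are members;
  `projTypes_config`: the projected family `Z.image (·.erase y)` with `projTypes` is again a type-set configuration on `G.erase y`
  (complement-closed, nonempty, equivariant).
* `typeMeets_proj` (**exact projection**): `typeMeets (Z.image (·.erase y)) (projTypes Z L y) = (typeMeets Z L).image (·.erase y)` —
  not merely `⊆`: every compatible meet of `Z` projects to a compatible meet of the projection and conversely.  Hence
  (`card_typeMeets_eq_proj_add_twins`) `#typeMeets Z L = #typeMeets Z' L' + #twins`, twins = `bothLifts (typeMeets Z L) y`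
  (gen 41's fibre count).
* `sum_tsWeight_proj` (weight bookkeeping): `Σ_{z∈Z} w(L z) + Σ_{u ∈ D} w(L' u) = Σ_{u ∈ Z'} w(L' u) + Σ_{u ∈ D} (w(L u) + w(L (insert y u)))`,
  `D = bothLifts Z y` the doubled members.  Together: the SLACK IDENTITY `slack(Z) = slack(Z'_y) + tw_y − def_y` of the memo, and
  `typeSet_step`: the inequality for `Z` follows from the inequality for its projection plus the twin inequality
  `Σ_{u∈D} (w(L u) + w(L (y+u))) ≤ Σ_{u∈D} w(L' u) + 2·#twins` at ONE point `y`.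
CAVEAT recorded in the memo (§3): the twin inequality FAILS at every point of certain tight, highly symmetric configurations
(found from `|G| = 5` on), so `typeSet_step` alone is not a proof strategy; it is the exact bookkeeping any compression argument
must start from.  HONEST FRAMING: structural theorems about an OPEN conjecture; nothing is claimed about the conjecture itself. [this work]
-/

namespace Summit.CriticalPhenomena.PercolationContinuityZ3.Theorems.SahiColouredDaykin

open Finset

variable {α : Type*} [DecidableEq α]

/-! ### 1. Weights -/

/-- The weight of a type-set: `2` if self-compatible, else `1`. [this work] -/
def tsWeight (S : Finset (ℕ × Bool)) : ℕ := if lcompat S S = true then 2 else 1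

omit [DecidableEq α] in
/-- `Σ_{z ∈ Z} tsWeight (L z) = #Z + #{z ∈ Z : L z self-compatible}` — the left-hand side of `TypeSetSignedDaykin`. [this work] -/
theorem sum_tsWeight_eq (Z : Finset (Finset α)) (L : Finset α → Finset (ℕ × Bool)) :
    ∑ z ∈ Z, tsWeight (L z) = #Z + #(Z.filter fun z => lcompat (L z) (L z) = true) := by
  have h : ∀ z ∈ Z, tsWeight (L z) = 1 + (if lcompat (L z) (L z) = true then 1 else 0) := by
    intro z _; unfold tsWeight; split_ifs <;> rfl
  rw [sum_congr rfl h, sum_add_distrib, sum_const, smul_eq_mul, mul_one, ← card_filter]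

/-- `lcompat` is monotone in both arguments. [this work] -/
theorem lcompat_mono {A A' B B' : Finset (ℕ × Bool)} (hA : A ⊆ A') (hB : B ⊆ B') (h : lcompat A B = true) :
    lcompat A' B' = true := by
  rw [lcompat_iff] at h ⊢
  obtain ⟨t, ht, u, hu, htu⟩ := h
  exact ⟨t, hA ht, u, hB hu, htu⟩

/-- `tcompat` is symmetric. [this work] -/
theorem tcompat_comm (t u : ℕ × Bool) : tcompat t u = tcompat u t := by
  unfold tcompat
  by_cases h1 : t.1 = u.1 <;> by_cases h2 : t.2 = u.2 <;> simp [h1, h2, eq_comm]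

/-- `tcompat` is invariant under flipping both signs. [this work] -/
theorem tcompat_flipT (t u : ℕ × Bool) : tcompat (flipT t) (flipT u) = tcompat t u := by
  unfold tcompat flipT
  by_cases h1 : t.1 = u.1 <;> by_cases h2 : t.2 = u.2 <;> simp [h1, h2]

/-- `lcompat` is invariant under flipping both type-sets. [this work] -/
theorem lcompat_image_flipT (A B : Finset (ℕ × Bool)) :
    lcompat (A.image flipT) (B.image flipT) = lcompat A B := by
  have key : (lcompat (A.image flipT) (B.image flipT) = true) ↔ (lcompat A B = true) := by
    rw [lcompat_iff, lcompat_iff]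
    constructor
    · rintro ⟨t, ht, u, hu, htu⟩
      obtain ⟨t0, ht0, rfl⟩ := mem_image.1 ht
      obtain ⟨u0, hu0, rfl⟩ := mem_image.1 hu
      exact ⟨t0, ht0, u0, hu0, by rwa [tcompat_flipT] at htu⟩
    · rintro ⟨t, ht, u, hu, htu⟩
      exact ⟨flipT t, mem_image_of_mem _ ht, flipT u, mem_image_of_mem _ hu, by rwa [tcompat_flipT]⟩
  by_cases h : lcompat A B = true
  · rw [h]; exact key.2 h
  · have h' : lcompat (A.image flipT) (B.image flipT) ≠ true := fun hh => h (key.1 hh)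
    rw [Bool.eq_false_iff.2 h, Bool.eq_false_iff.2 h']

/-- The weight is invariant under flipping. [this work] -/
theorem tsWeight_image_flipT (S : Finset (ℕ × Bool)) : tsWeight (S.image flipT) = tsWeight S := by
  unfold tsWeight; rw [lcompat_image_flipT]

/-! ### 2. The projected type-sets -/

section proj

variable (Z : Finset (Finset α)) (L : Finset α → Finset (ℕ × Bool)) (y : α)

/-- The UNION TYPE-SET of a `y`-free set `u` in the projection: the types of its lifts `u` and `insert y u` that are members of
`Z`. [this work] -/
def projTypes (u : Finset α) : Finset (ℕ × Bool) :=
  (if u ∈ Z then L u else ∅) ∪ (if insert y u ∈ Z then L (insert y u) else ∅)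

variable {Z L y}

/-- A type of the projection comes from one of the two lifts. [this work] -/
theorem mem_projTypes {u : Finset α} {t : ℕ × Bool} (ht : t ∈ projTypes Z L y u) :
    (u ∈ Z ∧ t ∈ L u) ∨ (insert y u ∈ Z ∧ t ∈ L (insert y u)) := by
  unfold projTypes at ht
  rcases mem_union.1 ht with h | h
  · by_cases hu : u ∈ Z
    · rw [if_pos hu] at h; exact Or.inl ⟨hu, h⟩
    · rw [if_neg hu] at h; exact absurd h (notMem_empty t)
  · by_cases hu : insert y u ∈ Z
    · rw [if_pos hu] at h; exact Or.inr ⟨hu, h⟩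
    · rw [if_neg hu] at h; exact absurd h (notMem_empty t)

/-- The type-set of a member is contained in the union type-set of its projection. [this work] -/
theorem subset_projTypes_erase {z : Finset α} (hz : z ∈ Z) : L z ⊆ projTypes Z L y (z.erase y) := by
  intro t ht
  unfold projTypes
  by_cases hy : y ∈ z
  · have : insert y (z.erase y) = z := insert_erase hy
    refine mem_union.2 (Or.inr ?_)
    rw [this, if_pos hz]; exact ht
  · have : z.erase y = z := erase_eq_of_notMem hy
    refine mem_union.2 (Or.inl ?_)
    rw [this, if_pos hz]; exact ht

/-- Members of the projection are `y`-free. [this work] -/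
theorem notMem_of_mem_image_erase {u : Finset α} (hu : u ∈ Z.image fun s => s.erase y) : y ∉ u := by
  obtain ⟨z, _, rfl⟩ := mem_image.1 hu
  exact notMem_erase y z

/-- A member of the projection has a lift. [this work] -/
theorem exists_lift_of_mem_image_erase {u : Finset α} (hu : u ∈ Z.image fun s => s.erase y) :
    u ∈ Z ∨ insert y u ∈ Z := by
  obtain ⟨z, hz, rfl⟩ := mem_image.1 hu
  by_cases hy : y ∈ z
  · right; rwa [insert_erase hy]
  · left; rwa [erase_eq_of_notMem hy]

/-- The union type-set of a projected member is nonempty. [this work] -/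
theorem projTypes_nonempty (hne : ∀ z ∈ Z, (L z).Nonempty) {u : Finset α} (hu : u ∈ Z.image fun s => s.erase y) :
    (projTypes Z L y u).Nonempty := by
  rcases exists_lift_of_mem_image_erase hu with h | h
  · obtain ⟨t, ht⟩ := hne u h
    exact ⟨t, by unfold projTypes; rw [if_pos h]; exact mem_union_left _ ht⟩
  · obtain ⟨t, ht⟩ := hne _ h
    exact ⟨t, by unfold projTypes; rw [if_pos h]; exact mem_union_right _ ht⟩

/-! ### 3. The projection is a configuration on `G.erase y` -/

variable {G : Finset α}

/-- Projected members lie in `G.erase y`. [this work] -/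
theorem proj_subset (hZG : ∀ z ∈ Z, z ⊆ G) {u : Finset α} (hu : u ∈ Z.image fun s => s.erase y) : u ⊆ G.erase y := by
  obtain ⟨z, hz, rfl⟩ := mem_image.1 hu
  exact erase_subset_erase y (hZG z hz)

/-- The projection is closed under complement in `G.erase y`. [this work] -/
theorem proj_compl_mem (hcc : ∀ z ∈ Z, G \ z ∈ Z) {u : Finset α} (hu : u ∈ Z.image fun s => s.erase y) :
    (G.erase y) \ u ∈ Z.image fun s => s.erase y := by
  obtain ⟨z, hz, rfl⟩ := mem_image.1 hu
  refine mem_image.2 ⟨G \ z, hcc z hz, ?_⟩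
  ext a
  simp only [mem_erase, mem_sdiff]
  tauto

/-- For `y ∈ G`, `y ∉ u`, `u ⊆ G`: the complement of `u` in `G.erase y` is `G \ insert y u`, and inserting `y` into it gives `G \ u`.
[folklore] -/
theorem insert_erase_sdiff_eq (hy : y ∈ G) {u : Finset α} (hyu : y ∉ u) :
    insert y ((G.erase y) \ u) = G \ u := by
  ext a
  simp only [mem_insert, mem_sdiff, mem_erase]
  constructor
  · rintro (rfl | ⟨⟨_, haG⟩, hau⟩)
    · exact ⟨hy, hyu⟩
    · exact ⟨haG, hau⟩
  · rintro ⟨haG, hau⟩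
    by_cases hay : a = y
    · exact Or.inl hay
    · exact Or.inr ⟨⟨hay, haG⟩, hau⟩

/-- **Equivariance of the projected type-sets.**  For `u` in the projection,
`projTypes ((G.erase y) \ u) = flipT '' projTypes u`. [this work] -/
theorem projTypes_compl (hy : y ∈ G) (hZG : ∀ z ∈ Z, z ⊆ G) (hcc : ∀ z ∈ Z, G \ z ∈ Z)
    (hflip : ∀ z ∈ Z, L (G \ z) = (L z).image flipT) {u : Finset α} (hu : u ∈ Z.image fun s => s.erase y) :
    projTypes Z L y ((G.erase y) \ u) = (projTypes Z L y u).image flipT := by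
  have hyu : y ∉ u := notMem_of_mem_image_erase hu
  have huG : u ⊆ G := (proj_subset hZG hu).trans (erase_subset y G)
  have hyuG : insert y u ⊆ G := insert_subset hy huG
  -- the two lifts of the complement
  have e1 : (G.erase y) \ u = G \ insert y u := erase_sdiff_eq_sdiff_insert G u y
  have e2 : insert y ((G.erase y) \ u) = G \ u := insert_erase_sdiff_eq hy hyu
  -- membership equivalences
  have m1 : (G \ insert y u ∈ Z) ↔ (insert y u ∈ Z) := by
    constructor
    · intro h; have := hcc _ h; rwa [Finset.sdiff_sdiff_eq_self hyuG] at this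
    · intro h; exact hcc _ h
  have m2 : (G \ u ∈ Z) ↔ (u ∈ Z) := by
    constructor
    · intro h; have := hcc _ h; rwa [Finset.sdiff_sdiff_eq_self huG] at this
    · intro h; exact hcc _ h
  unfold projTypes
  rw [e2, e1, image_union]
  -- rewrite each guarded piece
  have p1 : (if G \ insert y u ∈ Z then L (G \ insert y u) else ∅) =
      (if insert y u ∈ Z then L (insert y u) else ∅).image flipT := by
    by_cases h : insert y u ∈ Z
    · rw [if_pos (m1.2 h), if_pos h, hflip _ h]
    · rw [if_neg (fun hh => h (m1.1 hh)), if_neg h, image_empty]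
  have p2 : (if G \ u ∈ Z then L (G \ u) else ∅) = (if u ∈ Z then L u else ∅).image flipT := by
    by_cases h : u ∈ Z
    · rw [if_pos (m2.2 h), if_pos h, hflip _ h]
    · rw [if_neg (fun hh => h (m2.1 hh)), if_neg h, image_empty]
  rw [p1, p2, union_comm]

/-- **The projection is a type-set configuration on `G.erase y`** (all four hypotheses of `TypeSetSignedDaykin`). [this work] -/
theorem projTypes_config (hy : y ∈ G) (hZG : ∀ z ∈ Z, z ⊆ G) (hcc : ∀ z ∈ Z, G \ z ∈ Z) (hne : ∀ z ∈ Z, (L z).Nonempty)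
    (hflip : ∀ z ∈ Z, L (G \ z) = (L z).image flipT) :
    (∀ u ∈ Z.image (fun s => s.erase y), u ⊆ G.erase y) ∧
    (∀ u ∈ Z.image (fun s => s.erase y), (G.erase y) \ u ∈ Z.image (fun s => s.erase y)) ∧
    (∀ u ∈ Z.image (fun s => s.erase y), (projTypes Z L y u).Nonempty) ∧
    (∀ u ∈ Z.image (fun s => s.erase y), projTypes Z L y ((G.erase y) \ u) = (projTypes Z L y u).image flipT) :=
  ⟨fun _ hu => proj_subset hZG hu, fun _ hu => proj_compl_mem hcc hu, fun _ hu => projTypes_nonempty hne hu,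
    fun _ hu => projTypes_compl hy hZG hcc hflip hu⟩

/-! ### 4. Exact projection of the compatible meets -/

/-- Erasing distributes over intersection. [folklore] -/
theorem erase_inter_erase (a b : Finset α) : (a ∩ b).erase y = a.erase y ∩ b.erase y := by
  ext t; simp only [mem_erase, mem_inter]; tauto

/-- **Exact projection**: the compatible meets of the projected configuration are exactly the projections of the compatible
meets. [this work] -/
theorem typeMeets_proj :
    typeMeets (Z.image fun s => s.erase y) (projTypes Z L y) = (typeMeets Z L).image fun s => s.erase y := by
  ext w
  constructor
  · intro hw
    obtain ⟨u, hu, v, hv, hc, rfl⟩ := mem_typeMeets_iff.1 hw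
    obtain ⟨t, ht, t', ht', htt⟩ := (lcompat_iff _ _).1 hc
    have hyu : y ∉ u := notMem_of_mem_image_erase hu
    have hyv : y ∉ v := notMem_of_mem_image_erase hv
    -- choose lifts carrying the two types
    have liftu : ∃ a ∈ Z, t ∈ L a ∧ a.erase y = u := by
      rcases mem_projTypes ht with ⟨h1, h2⟩ | ⟨h1, h2⟩
      · exact ⟨u, h1, h2, erase_eq_of_notMem hyu⟩
      · exact ⟨insert y u, h1, h2, erase_insert hyu⟩
    have liftv : ∃ b ∈ Z, t' ∈ L b ∧ b.erase y = v := by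
      rcases mem_projTypes ht' with ⟨h1, h2⟩ | ⟨h1, h2⟩
      · exact ⟨v, h1, h2, erase_eq_of_notMem hyv⟩
      · exact ⟨insert y v, h1, h2, erase_insert hyv⟩
    obtain ⟨a, ha, hta, rfl⟩ := liftu
    obtain ⟨b, hb, htb, rfl⟩ := liftv
    have hab : lcompat (L a) (L b) = true := (lcompat_iff _ _).2 ⟨t, hta, t', htb, htt⟩
    refine mem_image.2 ⟨a ∩ b, mem_typeMeets_iff.2 ⟨a, ha, b, hb, hab, rfl⟩, ?_⟩
    exact erase_inter_erase a b
  · intro hw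
    obtain ⟨m, hm, rfl⟩ := mem_image.1 hw
    obtain ⟨a, ha, b, hb, hab, rfl⟩ := mem_typeMeets_iff.1 hm
    refine mem_typeMeets_iff.2 ⟨a.erase y, mem_image_of_mem _ ha, b.erase y, mem_image_of_mem _ hb, ?_, ?_⟩
    · exact lcompat_mono (subset_projTypes_erase ha) (subset_projTypes_erase hb) hab
    · exact (erase_inter_erase a b).symm

/-- **`#typeMeets Z L = #typeMeets Z' L' + #twins`**, with twins = the `y`-free compatible meets `w` such that `insert y w` is also a
compatible meet. [this work] -/
theorem card_typeMeets_eq_proj_add_twins :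
    #(typeMeets Z L) = #(typeMeets (Z.image fun s => s.erase y) (projTypes Z L y)) + #(bothLifts (typeMeets Z L) y) := by
  rw [typeMeets_proj, card_image_erase_add_card_bothLifts]

/-! ### 5. Weight bookkeeping and the step -/

/-- On a `y`-free non-doubled member (only the lift `u`), the union type-set is `L u`. [this work] -/
theorem projTypes_of_only_lower {u : Finset α} (hu : u ∈ Z) (hnu : insert y u ∉ Z) : projTypes Z L y u = L u := by
  unfold projTypes; rw [if_pos hu, if_neg hnu, union_empty]

/-- On a projected member with only the lift `insert y u`, the union type-set is `L (insert y u)`. [this work] -/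
theorem projTypes_of_only_upper {u : Finset α} (hnu : u ∉ Z) (hu : insert y u ∈ Z) : projTypes Z L y u = L (insert y u) := by
  unfold projTypes; rw [if_neg hnu, if_pos hu, empty_union]

/-- **Weight bookkeeping**: `Σ_{z ∈ Z} w(L z) + Σ_{u ∈ D} w(L' u) = Σ_{u ∈ Z'} w(L' u) + Σ_{u ∈ D} (w(L u) + w(L (insert y u)))`, where
`Z' = Z.image (·.erase y)`, `L' = projTypes`, `D = bothLifts Z y` (the doubled members). [this work] -/
theorem sum_tsWeight_proj :
    ∑ z ∈ Z, tsWeight (L z) + ∑ u ∈ bothLifts Z y, tsWeight (projTypes Z L y u) =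
      ∑ u ∈ Z.image (fun s => s.erase y), tsWeight (projTypes Z L y u) +
        ∑ u ∈ bothLifts Z y, (tsWeight (L u) + tsWeight (L (insert y u))) := by
  set M := Z.memberSubfamily y with hM
  set N := Z.nonMemberSubfamily y with hN
  have hZ' : Z.image (fun s => s.erase y) = M ∪ N := (memberSubfamily_union_nonMemberSubfamily y Z).symm
  have hD : bothLifts Z y = M ∩ N := rfl
  -- split Σ_{z ∈ Z} by `y ∈ z`
  have hsplit : ∑ z ∈ Z, tsWeight (L z) =
      ∑ u ∈ M, tsWeight (L (insert y u)) + ∑ u ∈ N, tsWeight (L u) := by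
    rw [← sum_filter_add_sum_filter_not Z (fun z => y ∈ z)]
    congr 1
    · -- members containing y ↔ M via erase / insert
      rw [hM, memberSubfamily, sum_image]
      · refine sum_congr rfl fun z hz => ?_
        rw [insert_erase (mem_filter.1 hz).2]
      · exact (erase_injOn' y).mono fun z hz => by
          have := (mem_filter.1 (mem_coe.1 hz)).2; exact this
  -- split Σ over Z' = M ∪ N into (M \ N) ∪ N and Σ over N into (N \ M) ∪ (M ∩ N), similarly M
  have hM' : ∑ u ∈ M, tsWeight (L (insert y u)) =
      ∑ u ∈ M \ N, tsWeight (L (insert y u)) + ∑ u ∈ M ∩ N, tsWeight (L (insert y u)) := by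
    rw [← sum_union (disjoint_sdiff_inter M N), sdiff_union_inter]
  have hN' : ∑ u ∈ N, tsWeight (L u) = ∑ u ∈ N \ M, tsWeight (L u) + ∑ u ∈ M ∩ N, tsWeight (L u) := by
    rw [inter_comm, ← sum_union (disjoint_sdiff_inter N M), sdiff_union_inter]
  have hU : ∑ u ∈ M ∪ N, tsWeight (projTypes Z L y u) =
      ∑ u ∈ M \ N, tsWeight (projTypes Z L y u) + ∑ u ∈ N \ M, tsWeight (projTypes Z L y u) +
        ∑ u ∈ M ∩ N, tsWeight (projTypes Z L y u) := by
    have e : M ∪ N = (M \ N ∪ N \ M) ∪ (M ∩ N) := by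
      ext u; simp only [mem_union, mem_sdiff, mem_inter]; tauto
    have d1 : Disjoint (M \ N) (N \ M) := by
      rw [disjoint_left]; intro u h1 h2; exact (mem_sdiff.1 h1).2 (mem_sdiff.1 h2).1
    have d2 : Disjoint (M \ N ∪ N \ M) (M ∩ N) := by
      rw [disjoint_left]; intro u h1 h2
      rcases mem_union.1 h1 with h | h
      · exact (mem_sdiff.1 h).2 (mem_inter.1 h2).2
      · exact (mem_sdiff.1 h).2 (mem_inter.1 h2).1
    rw [e, sum_union d2, sum_union d1]
  -- on M \ N and N \ M the union type-set is a single lift's type-set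
  have hMN : ∑ u ∈ M \ N, tsWeight (projTypes Z L y u) = ∑ u ∈ M \ N, tsWeight (L (insert y u)) := by
    refine sum_congr rfl fun u hu => ?_
    obtain ⟨huM, huN⟩ := mem_sdiff.1 hu
    have h1 := (mem_memberSubfamily.1 huM)
    have hnu : u ∉ Z := fun h => huN (mem_nonMemberSubfamily.2 ⟨h, h1.2⟩)
    rw [projTypes_of_only_upper hnu h1.1]
  have hNM : ∑ u ∈ N \ M, tsWeight (projTypes Z L y u) = ∑ u ∈ N \ M, tsWeight (L u) := by
    refine sum_congr rfl fun u hu => ?_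
    obtain ⟨huN, huM⟩ := mem_sdiff.1 hu
    have h1 := (mem_nonMemberSubfamily.1 huN)
    have hnu : insert y u ∉ Z := fun h => huM (mem_memberSubfamily.2 ⟨h, h1.2⟩)
    rw [projTypes_of_only_lower h1.1 hnu]
  rw [hZ', hU, hMN, hNM, hsplit, hM', hN', hD, sum_add_distrib]
  ring

/-- **The compression step.**  If the inequality of `TypeSetSignedDaykin` holds for the projection at `y` and the doubled members satisfy
the TWIN INEQUALITY `Σ_{u ∈ D} (w(L u) + w(L (insert y u))) ≤ Σ_{u ∈ D} w(L' u) + 2·#twins`, then the inequality holds for `Z`.  (The memo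
records configurations where the twin inequality fails at every point; this is bookkeeping, not a proof strategy by itself.) [this work] -/
theorem typeSet_step
    (hIH : ∑ u ∈ Z.image (fun s => s.erase y), tsWeight (projTypes Z L y u) ≤
      2 * #(typeMeets (Z.image fun s => s.erase y) (projTypes Z L y)))
    (htw : ∑ u ∈ bothLifts Z y, (tsWeight (L u) + tsWeight (L (insert y u))) ≤
      ∑ u ∈ bothLifts Z y, tsWeight (projTypes Z L y u) + 2 * #(bothLifts (typeMeets Z L) y)) :
    ∑ z ∈ Z, tsWeight (L z) ≤ 2 * #(typeMeets Z L) := by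
  have h1 := sum_tsWeight_proj (Z := Z) (L := L) (y := y)
  have h2 := card_typeMeets_eq_proj_add_twins (Z := Z) (L := L) (y := y)
  omega

/-- The same step in the `#Z + #{self-compatible}` form of the conjecture. [this work] -/
theorem typeSet_step'
    (hIH : #(Z.image fun s => s.erase y) +
        #((Z.image fun s => s.erase y).filter fun u => lcompat (projTypes Z L y u) (projTypes Z L y u) = true) ≤
      2 * #(typeMeets (Z.image fun s => s.erase y) (projTypes Z L y)))
    (htw : ∑ u ∈ bothLifts Z y, (tsWeight (L u) + tsWeight (L (insert y u))) ≤
      ∑ u ∈ bothLifts Z y, tsWeight (projTypes Z L y u) + 2 * #(bothLifts (typeMeets Z L) y)) :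
    #Z + #(Z.filter fun z => lcompat (L z) (L z) = true) ≤ 2 * #(typeMeets Z L) := by
  rw [← sum_tsWeight_eq] at hIH ⊢
  exact typeSet_step hIH htw

end proj

end Summit.CriticalPhenomena.PercolationContinuityZ3.Theorems.SahiColouredDaykin
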